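import Summits.ResolutionOfSingularities.ResolutionOfSingularities.Theorems.PurelyInseparableDim4ResConeTwoSlotDivisibilityPow
import Summits.ResolutionOfSingularities.ResolutionOfSingularities.Theorems.PurelyInseparableDim4TschirnhausJet
import Summits.ResolutionOfSingularities.ResolutionOfSingularities.Theorems.PurelyInseparableDim4TschirnhausFrame
import Summits.ResolutionOfSingularities.ResolutionOfSingularities.Theorems.PurelyInseparableDim4ResConeExceptionalRestriction
import Summits.ResolutionOfSingularities.ResolutionOfSingularities.Theorems.PurelyInseparableDim4ResConeTransport
import HarnessLib
import HarnessLib.Audit.Tags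

/-!
# Purely inseparable four-folds — EXISTENCE OF THE SECOND TSCHIRNHAUS `ū = u − ψ(x_λ, x_μ)` at one state
# (cell `res-dim4-pi`, K2(p) lane, slice B; K24b-FRAME, the `u`-half «(E-u)» of the one-state re-framing)

[OURS · counted 0 · cell `res-dim4-pi` · K2(p) lane holder res-dim4-p-12 g3's ruling (iii) (bus 2026-08-29
02:51:49Z) and «typ-1 g3 takes (E-u)» (03:26:45Z); spec res-dim4-idea-4 g3 HANDOFF-g3 §11 («SECOND TSCHIRNHAUS
ū := u − ψ(x_λ,x_μ) killing the ū²-coefficient: S₀ = B₀ + ūB₁ + ū³V, V unit, char 5»); seat res-dim4-typ-1 g3.]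
Nothing here proves K2(p)/K2(5), `NoIsolatedTrap 5 5` or resolution of singularities in dimension ≥ 4 /
characteristic `p` — NOT proved.  AI kernel work, weaker than expert review.

SETTING (fixed distinct letters `λ, μ, u, f`; `G` = the residual of a C∞ state in res-dim4-p-1 g4's canonical
`x_f`-jet frame `exists_canonical_frame_state`).  INPUT, all by value: `3 ≠ 0` in `K`; the pair-ledger READ-OFF
on the `x_f`-free rows `hled : coeff_n G = 0` for `n_f = 0`, `|n| < M`, `n_λ = 0 ∨ n_μ = 0` (typ-1 g3's βC3(4)
`frame_reading_eq_zero_of_born_four` / `coeff_map_eq_zero_of_pair_ledger_pow`); the `u`-FLAG VALUE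
`V(0) = coeff_{x_λ x_μ u³} G ≠ 0`; the ENTRY `coeff_{x_λ x_μ u²} G = 0` (a degree-`4` monomial other than `x_f⁴`:
straightness).  OUTPUT (§3 **`exists_second_tschirnhaus`**): for every `N` a polynomial `ψ ∈ K[x_λ, x_μ]`
(`ψ(0) = 0`, `u, f ∉ vars ψ`; a linear part is allowed) such that the frame move `τ = FrameChange.tsch u ψ`
(`x_u ↦ x_u + ψ`) kills the `ū²`-ROW in jet form — `coeff_m (τ G) = 0` for `m_u = 2`, `m_f = 0`, `|m| ≤ N + 4`,
`|m| < M` — keeps `V(0)` and keeps the read-off `hled`.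
MECHANISM.  §1: below degree `M` the `x_f`-free part of `G` is `x_λ x_μ · S` EXACTLY, `S := (G|_{x_f=0}) / x_λx_μ`
(`divMonomial`; the discarded monomials are `hled`-dead), so `G = x_λ x_μ·S + R` with `R ∈ (x_f) + 𝔪₀^M`, an ideal
preserved by every origin-fixing `τ` fixing `x_f` (§1 `coeff_tsch_eq_of_lowRows`).  §2: `S ∈ K[x_λ, x_μ, u]` has
`coeff_{u³} S = V(0) ≠ 0` and `coeff_{u²} S = 0`, so res-dim4-p-1 g3's FILE D `FrameChange.exists_jet` (letter `u`,
`d = 3`) gives a jet `φ` killing the `u²·m`-rows of `S(x_u + φ)`; `φ` may involve `x_f`, but `ψ := φ|_{x_f = 0}`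
does the same job on the `x_f`-free rows (`S(x_u + φ) ≡ S(x_u + ψ) mod (x_f)`, p-7's
`ApproxCoordChange.aeval_sub_aeval_mem`).  §3 assembles; `V(0)` is kept by FILE D's `coeff_single_frameChange`.
What is NOT here: the `x_f`-frame (β1, res-dim4-p-1 g4), the chain-level dress, the persistence of the dead row
under corner steps (F1 (P) `cInf_normalForm_step_zero` for the full row; the jet form's `N − 4t` bookkeeping is
F2c's, res-dim4-p-2 g4), the straightness / `x_f`-jet bookkeeping under `τ` (next file).
[cite: Abhyankar1990, Lecture 25 pp. 216–217 and Lecture 26 pp. 228–229] [cite: CossartPiltant2009, I.8.3.6]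
bears_on: LADDER-RESOLUTION:D157-DOOR2 (res-dim4-pi · K2(p) · slice B · K24b-FRAME (E-u)).  Supports
stmt-ResolutionOfSingularities-16155 (helper).
-/

set_option linter.dupNamespace false -- mandated namespace of this single-conjunct summit

noncomputable section

namespace Summit.ResolutionOfSingularities.ResolutionOfSingularities.Theorems.PIDim4

namespace ResCone

open MvPolynomial Finset FrameChange
open Literature.AlgebraicGeometry.Resolution

variable {K : Type} [Field K]

/-! ## 1. Below degree `M` the `x_f`-free part of `G` is `x_λ x_μ · S` -/

/-- An element of `(x_f) + 𝔪₀^M` has no `x_f`-free monomial of degree `< M`. [folklore] -/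
theorem coeff_eq_zero_of_mem_span_X_sup {f : Fin 4} {M : ℕ} {R : MvPolynomial (Fin 4) K}
    (hR : R ∈ Ideal.span {(X f : MvPolynomial (Fin 4) K)} ⊔ originIdeal K ^ M) {n : Fin 4 →₀ ℕ}
    (hnf : n f = 0) (hnM : n.degree < M) : coeff n R = 0 := by
  obtain ⟨y, hy, z, hz, rfl⟩ := Submodule.mem_sup.mp hR
  rw [← pow_one (X f)] at hy
  rw [coeff_add, coeff_eq_zero_of_mem_span_X_pow hy (n := n) (by omega),
    coeff_eq_zero_of_mem_originIdeal_pow hz hnM, add_zero]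

/-- A polynomial without `x_f`-free monomials of degree `< M` lies in `(x_f) + 𝔪₀^M`. [folklore] -/
theorem mem_span_X_sup_of_coeff {f : Fin 4} {M : ℕ} {R : MvPolynomial (Fin 4) K}
    (hR : ∀ n : Fin 4 →₀ ℕ, n f = 0 → n.degree < M → coeff n R = 0) :
    R ∈ Ideal.span {(X f : MvPolynomial (Fin 4) K)} ⊔ originIdeal K ^ M := by
  rw [← sub_add_cancel R (PointBlowup.killVar f R)]
  refine Submodule.add_mem_sup (sub_killVar_mem_span_X f R) ?_
  rw [IsolationCert.mem_originIdeal_pow_iff]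
  intro d hd
  rw [coeff_killVar]
  split_ifs with hdf
  · exact hR d hdf hd
  · rfl

/-- `(x_f) + 𝔪₀^M` is stable under every origin-fixing `K`-algebra endomorphism fixing `x_f`. [folklore] -/
theorem map_mem_span_X_sup (τ : MvPolynomial (Fin 4) K →ₐ[K] MvPolynomial (Fin 4) K) {f : Fin 4}
    (hτf : τ (X f) = X f) (hτ0 : ∀ i, constantCoeff (τ (X i)) = 0) {M : ℕ} {R : MvPolynomial (Fin 4) K}
    (hR : R ∈ Ideal.span {(X f : MvPolynomial (Fin 4) K)} ⊔ originIdeal K ^ M) :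
    τ R ∈ Ideal.span {(X f : MvPolynomial (Fin 4) K)} ⊔ originIdeal K ^ M := by
  obtain ⟨y, hy, z, hz, rfl⟩ := Submodule.mem_sup.mp hR
  rw [map_add]
  refine Submodule.add_mem_sup ?_ (map_mem_originIdeal_pow_of_origin τ hτ0 hz)
  obtain ⟨q, rfl⟩ := Ideal.mem_span_singleton'.mp hy
  rw [map_mul, hτf]
  exact Ideal.mem_span_singleton'.mpr ⟨τ q, rfl⟩


/-- `x_λ x_μ ∣ x^m` iff both exponents are positive (`λ ≠ μ`). [folklore] -/
theorem pair_le_iff {lam mu : Fin 4} (hlm : lam ≠ mu) (m : Fin 4 →₀ ℕ) :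
    Finsupp.single lam 1 + Finsupp.single mu 1 ≤ m ↔ 1 ≤ m lam ∧ 1 ≤ m mu := by
  constructor
  · intro h
    have h1 := h lam
    have h2 := h mu
    rw [Finsupp.add_apply, Finsupp.single_eq_same, Finsupp.single_eq_of_ne hlm] at h1
    rw [Finsupp.add_apply, Finsupp.single_eq_of_ne hlm.symm, Finsupp.single_eq_same] at h2
    exact ⟨by omega, by omega⟩
  · rintro ⟨h1, h2⟩ i
    simp only [Finsupp.add_apply, Finsupp.single_apply]
    split_ifs <;> subst_vars <;> omega

/-- Values of `x_λ x_μ` at a third letter. [folklore] -/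
theorem pair_apply_of_ne {lam mu i : Fin 4} (hil : i ≠ lam) (him : i ≠ mu) :
    (Finsupp.single lam 1 + Finsupp.single mu 1 : Fin 4 →₀ ℕ) i = 0 := by
  rw [Finsupp.add_apply, Finsupp.single_apply, Finsupp.single_apply, if_neg (Ne.symm hil), if_neg (Ne.symm him),
    add_zero]

/-- **Below degree `M` the `x_f`-free part of `G` is `x_λ x_μ · S`**, `S := (G|_{x_f = 0}) / x_λ x_μ`: under the
ledger read-off `hled`, `G − x_λ x_μ·S ∈ (x_f) + 𝔪₀^M`. [OURS] [folklore] -/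
theorem sub_pair_mul_mem {lam mu f : Fin 4} (hlm : lam ≠ mu) {G : MvPolynomial (Fin 4) K} {M : ℕ}
    (hled : ∀ n : Fin 4 →₀ ℕ, n f = 0 → n.degree < M → (n lam = 0 ∨ n mu = 0) → coeff n G = 0) :
    G - monomial (Finsupp.single lam 1 + Finsupp.single mu 1) 1 *
        (PointBlowup.killVar f G).divMonomial (Finsupp.single lam 1 + Finsupp.single mu 1) ∈
      Ideal.span {(X f : MvPolynomial (Fin 4) K)} ⊔ originIdeal K ^ M := by
  refine mem_span_X_sup_of_coeff fun n hnf hnM => ?_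
  rw [coeff_sub, coeff_monomial_mul']
  split_ifs with hle
  · rw [one_mul, coeff_divMonomial, add_tsub_cancel_of_le hle, coeff_killVar, if_pos hnf, sub_self]
  · have hn : n lam = 0 ∨ n mu = 0 := by
      rw [pair_le_iff hlm] at hle
      omega
    rw [hled n hnf hnM hn, sub_zero]

/-- **Reading `τ G` through `S`**: for an origin-fixing `K`-algebra endomorphism `τ` fixing `x_λ, x_μ, x_f`, every
`x_f`-free coefficient of `τ G` below degree `M` is the shifted coefficient of `τ S`:
`coeff_m (τ G) = [x_λ x_μ ∣ x^m] · coeff_{m − λ − μ} (τ S)`. [OURS] [folklore] -/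
theorem coeff_map_eq_of_lowRows (τ : MvPolynomial (Fin 4) K →ₐ[K] MvPolynomial (Fin 4) K)
    {lam mu f : Fin 4} (hlm : lam ≠ mu) (hτl : τ (X lam) = X lam) (hτm : τ (X mu) = X mu) (hτf : τ (X f) = X f)
    (hτ0 : ∀ i, constantCoeff (τ (X i)) = 0) {G : MvPolynomial (Fin 4) K} {M : ℕ}
    (hled : ∀ n : Fin 4 →₀ ℕ, n f = 0 → n.degree < M → (n lam = 0 ∨ n mu = 0) → coeff n G = 0)
    {m : Fin 4 →₀ ℕ} (hmf : m f = 0) (hmM : m.degree < M) :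
    coeff m (τ G) =
      if Finsupp.single lam 1 + Finsupp.single mu 1 ≤ m then
        coeff (m - (Finsupp.single lam 1 + Finsupp.single mu 1))
          (τ ((PointBlowup.killVar f G).divMonomial (Finsupp.single lam 1 + Finsupp.single mu 1)))
      else 0 := by
  set s : Fin 4 →₀ ℕ := Finsupp.single lam 1 + Finsupp.single mu 1 with hs
  set S := (PointBlowup.killVar f G).divMonomial s with hS
  have hsplit : G = monomial s 1 * S + (G - monomial s 1 * S) := by ring
  have hR := map_mem_span_X_sup τ hτf hτ0 (sub_pair_mul_mem (M := M) hlm hled)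
  rw [hsplit, map_add, map_mul, coeff_add, coeff_eq_zero_of_mem_span_X_sup hR hmf hmM, add_zero, hs,
    map_monomial_pair τ hτl hτm, coeff_monomial_mul']
  split_ifs
  · rw [one_mul]
  · rfl

/-! ## 2. The `x_u`-jet of `S` and its `x_f`-free shadow -/

/-- **Two `u`-moves whose parameters agree modulo `x_f` agree on the `x_f`-free rows**:
`coeff_m (tsch u φ P) = coeff_m (tsch u ψ P)` for `m_f = 0` when `φ − ψ ∈ (x_f)`. [folklore] -/
theorem coeff_tsch_eq_of_sub_mem_span_X {u f : Fin 4} {φ ψ : MvPolynomial (Fin 4) K}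
    (h : φ - ψ ∈ Ideal.span {(X f : MvPolynomial (Fin 4) K)}) (P : MvPolynomial (Fin 4) K)
    {m : Fin 4 →₀ ℕ} (hmf : m f = 0) : coeff m (tsch u φ P) = coeff m (tsch u ψ P) := by
  have hdiff : tsch u φ P - tsch u ψ P ∈ Ideal.span {(X f : MvPolynomial (Fin 4) K)} := by
    unfold tsch
    refine ApproxCoordChange.aeval_sub_aeval_mem (fun i => ?_) P
    by_cases hi : i = u
    · simp only [hi, if_true, add_sub_add_left_eq_sub]
      exact h
    · simp only [if_neg hi, sub_self]
      exact Ideal.zero_mem _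
  rw [← pow_one (X f)] at hdiff
  have h0 := coeff_eq_zero_of_mem_span_X_pow hdiff (n := m) (by rw [hmf]; exact Nat.one_pos)
  rw [coeff_sub, sub_eq_zero] at h0
  exact h0

/-- **The `x_f`-free shadow of a `u`-jet**: if `φ` (`u ∉ vars φ`, `φ(0) = 0`) kills the rows `u²·x^m`, `m_u = 0`,
`|m| ≤ N`, of `tsch u φ P`, then so does `ψ := φ|_{x_f = 0}` on the `x_f`-free ones, and `ψ ∈ K[x_{≠ u, f}]`,
`ψ(0) = 0`. [OURS] [folklore] -/
theorem killVar_jet {u f : Fin 4} (huf : u ≠ f) {φ : MvPolynomial (Fin 4) K}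
    (hφs : ∀ a ∈ φ.support, a u = 0 ∧ 1 ≤ a.degree) (P : MvPolynomial (Fin 4) K) {N : ℕ}
    (hφj : ∀ m : Fin 4 →₀ ℕ, m u = 0 → m.degree ≤ N → coeff (m + Finsupp.single u 2) (tsch u φ P) = 0) :
    (∀ a ∈ (PointBlowup.killVar f φ).support, a u = 0 ∧ a f = 0 ∧ 1 ≤ a.degree) ∧
      constantCoeff (PointBlowup.killVar f φ) = 0 ∧ u ∉ (PointBlowup.killVar f φ).vars ∧
      f ∉ (PointBlowup.killVar f φ).vars ∧
      ∀ m : Fin 4 →₀ ℕ, m u = 0 → m f = 0 → m.degree ≤ N →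
        coeff (m + Finsupp.single u 2) (tsch u (PointBlowup.killVar f φ) P) = 0 := by
  have hsupp : ∀ a ∈ (PointBlowup.killVar f φ).support, a u = 0 ∧ a f = 0 ∧ 1 ≤ a.degree := by
    intro a ha
    rw [mem_support_iff, coeff_killVar] at ha
    by_cases haf : a f = 0
    · rw [if_pos haf] at ha
      obtain ⟨hau, hdeg⟩ := hφs a (mem_support_iff.mpr ha)
      exact ⟨hau, haf, hdeg⟩
    · rw [if_neg haf] at ha
      exact absurd rfl ha
  refine ⟨hsupp, ?_, ?_, ?_, fun m hmu hmf hmN => ?_⟩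
  · by_contra hne
    have h0 := (hsupp 0 (mem_support_iff.mpr hne)).2.2
    rw [map_zero] at h0
    exact Nat.not_succ_le_zero 0 h0
  · exact (not_mem_vars_iff u _).mpr fun d hd => (hsupp d hd).1
  · exact (not_mem_vars_iff f _).mpr fun d hd => (hsupp d hd).2.1
  · rw [← coeff_tsch_eq_of_sub_mem_span_X (sub_killVar_mem_span_X f φ) P
      (by rw [Finsupp.add_apply, hmf, Finsupp.single_eq_of_ne huf.symm, add_zero])]
    exact hφj m hmu hmN

/-! ## 3. Existence of the second Tschirnhaus -/

/-- **EXISTENCE OF THE SECOND TSCHIRNHAUS `ū = u − ψ(x_λ, x_μ)`** (K24b-FRAME (E-u); idea-4 §11).  Fixed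
distinct letters `λ, μ, u, f`; `G` with the `x_f`-free pair-ledger read-off below degree `M ≥ 6`, `u`-flag value
`coeff_{x_λx_μu³} G ≠ 0`, entry `coeff_{x_λx_μu²} G = 0`, and `3 ≠ 0` in `K`.  Then for every `N` there is
`ψ` with `ψ(0) = 0`, `u, f ∉ vars ψ` (so `ψ ∈ K[x_λ, x_μ]`: the support clause) such that `τ := tsch u ψ`
(i) kills the `ū²`-row in jet form: `coeff_m (τ G) = 0` for `m_u = 2`, `m_f = 0`, `|m| ≤ N + 4`, `|m| < M`;
(ii) keeps `V(0)`: `coeff_{x_λx_μu³} (τ G) = coeff_{x_λx_μu³} G`; (iii) keeps the read-off below degree `M`.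
[OURS] [cite: Abhyankar1990, Lecture 25 pp. 216–217 and Lecture 26 pp. 228–229] [cite: CossartPiltant2009, I.8.3.6] -/
theorem exists_second_tschirnhaus {lam mu u f : Fin 4} (hlm : lam ≠ mu) (hul : u ≠ lam) (hum : u ≠ mu) (hfl : f ≠ lam)
    (hfm : f ≠ mu) (hfu : f ≠ u) {G : MvPolynomial (Fin 4) K} {M : ℕ} (h3 : (3 : K) ≠ 0) (hM : 6 ≤ M)
    (hled : ∀ n : Fin 4 →₀ ℕ, n f = 0 → n.degree < M → (n lam = 0 ∨ n mu = 0) → coeff n G = 0)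
    (hV : coeff (Finsupp.single lam 1 + Finsupp.single mu 1 + Finsupp.single u 3) G ≠ 0)
    (h2 : coeff (Finsupp.single lam 1 + Finsupp.single mu 1 + Finsupp.single u 2) G = 0) (N : ℕ) :
    ∃ ψ : MvPolynomial (Fin 4) K, constantCoeff ψ = 0 ∧ u ∉ ψ.vars ∧ f ∉ ψ.vars ∧
      (∀ a ∈ ψ.support, a u = 0 ∧ a f = 0 ∧ 1 ≤ a.degree) ∧
      (∀ m : Fin 4 →₀ ℕ, m u = 2 → m f = 0 → m.degree ≤ N + 4 → m.degree < M →
        coeff m (tsch u ψ G) = 0) ∧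
      coeff (Finsupp.single lam 1 + Finsupp.single mu 1 + Finsupp.single u 3) (tsch u ψ G) =
        coeff (Finsupp.single lam 1 + Finsupp.single mu 1 + Finsupp.single u 3) G ∧
      (∀ n : Fin 4 →₀ ℕ, n f = 0 → n.degree < M → (n lam = 0 ∨ n mu = 0) → coeff n (tsch u ψ G) = 0) := by
  set s : Fin 4 →₀ ℕ := Finsupp.single lam 1 + Finsupp.single mu 1 with hs
  set S := (PointBlowup.killVar f G).divMonomial s with hS
  -- the readings of `S`
  have hSf : ∀ m : Fin 4 →₀ ℕ, coeff m S = if m f = 0 then coeff (s + m) G else 0 := by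
    intro m
    rw [hS, coeff_divMonomial, coeff_killVar]
    have : (s + m : Fin 4 →₀ ℕ) f = m f := by
      rw [Finsupp.add_apply, hs, pair_apply_of_ne hfl hfm, zero_add]
    rw [this]
  have huf3 : (Finsupp.single u 3 : Fin 4 →₀ ℕ) f = 0 := by rw [Finsupp.single_apply, if_neg hfu.symm]
  have huf2' : (Finsupp.single u 2 : Fin 4 →₀ ℕ) f = 0 := by rw [Finsupp.single_apply, if_neg hfu.symm]
  have huf2 : (Finsupp.single u (3 - 1) : Fin 4 →₀ ℕ) f = 0 := by rw [Finsupp.single_apply, if_neg hfu.symm]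
  have hc : coeff (Finsupp.single u 3) S ≠ 0 := by
    rw [hSf, if_pos huf3]; exact hV
  have h0 : coeff (Finsupp.single u (3 - 1)) S = 0 := by
    rw [hSf, if_pos huf2]; exact h2
  -- FILE D's jet solve at the letter `u`, `d = 3`
  obtain ⟨φ, hφs, -, hφj⟩ := FrameChange.exists_jet u (d := 3) (by norm_num) (by exact_mod_cast h3) S hc h0 N
  have hφj' : ∀ m : Fin 4 →₀ ℕ, m u = 0 → m.degree ≤ N →
      coeff (m + Finsupp.single u 2) (tsch u φ S) = 0 := fun m hmu hmN =>
    hφj (tsch u φ) (tsch_X_self u φ) (fun i hi => tsch_X_of_ne φ hi) m hmu hmN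
  -- its `x_f`-free shadow `ψ`
  obtain ⟨hψs, hψ0, hψu, hψf, hψj⟩ := killVar_jet hfu.symm hφs S hφj'
  set ψ := PointBlowup.killVar f φ with hψ
  have hτ0 : ∀ i, constantCoeff (tsch u ψ (X i)) = 0 := constantCoeff_tsch_X hψ0
  have hτl : tsch u ψ (X lam) = X lam := tsch_X_of_ne ψ hul.symm
  have hτm : tsch u ψ (X mu) = X mu := tsch_X_of_ne ψ hum.symm
  have hτf : tsch u ψ (X f) = X f := tsch_X_of_ne ψ hfu
  have hread := fun (m : Fin 4 →₀ ℕ) (hmf : m f = 0) (hmM : m.degree < M) =>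
    coeff_map_eq_of_lowRows (tsch u ψ) hlm hτl hτm hτf hτ0 hled hmf hmM
  refine ⟨ψ, hψ0, hψu, hψf, hψs, fun m hmu hmf hmN hmM => ?_, ?_, fun n hnf hnM hn => ?_⟩
  · -- (i) the `ū²`-row
    rw [hread m hmf hmM]
    split_ifs with hle
    · -- `m = m₀ + s + 2u` with `m₀ ∈ ⟨λ, μ⟩`-exponents of degree `≤ N`
      have hsu : s u = 0 := by rw [hs, pair_apply_of_ne hul hum]
      have hsf : s f = 0 := by rw [hs, pair_apply_of_ne hfl hfm]
      have hle2 : s + Finsupp.single u 2 ≤ m := by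
        intro i
        rw [Finsupp.add_apply, Finsupp.single_apply]
        by_cases hiu : u = i
        · rw [if_pos hiu, ← hiu, hsu, zero_add, hmu]
        · rw [if_neg hiu, add_zero]; exact hle i
      set m₀ := m - (s + Finsupp.single u 2) with hm₀
      have hm : m = m₀ + (s + Finsupp.single u 2) := (tsub_add_cancel_of_le hle2).symm
      have hsub : m - s = m₀ + Finsupp.single u 2 := by
        rw [hm, add_comm s, ← add_assoc, add_tsub_cancel_right]
      have hm₀u : m₀ u = 0 := by
        have := congrArg (fun g : Fin 4 →₀ ℕ => g u) hm
        simp only [Finsupp.add_apply, hmu, hsu, Finsupp.single_eq_same] at this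
        omega
      have hm₀f : m₀ f = 0 := by
        have := congrArg (fun g : Fin 4 →₀ ℕ => g f) hm
        simp only [Finsupp.add_apply, hmf, hsf, huf2'] at this
        omega
      have hm₀N : m₀.degree ≤ N := by
        have := congrArg Finsupp.degree hm
        simp only [map_add, hs, Finsupp.degree_single] at this
        omega
      rw [hsub]
      exact hψj m₀ hm₀u hm₀f hm₀N
    · rfl
  · -- (ii) `V(0)` is kept
    have hf5 : (s + Finsupp.single u 3 : Fin 4 →₀ ℕ) f = 0 := by
      rw [Finsupp.add_apply, hs, pair_apply_of_ne hfl hfm, huf3]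
    have hdeg : (s + Finsupp.single u 3).degree < M := by
      rw [map_add, hs, map_add, Finsupp.degree_single, Finsupp.degree_single, Finsupp.degree_single]; omega
    rw [show Finsupp.single lam 1 + Finsupp.single mu 1 + Finsupp.single u 3 = s + Finsupp.single u 3 by rw [hs],
      hread _ hf5 hdeg, if_pos le_self_add, add_tsub_cancel_left,
      FrameChange.coeff_single_frameChange (tsch u ψ) u ψ (tsch_X_self u ψ) (fun i hi => tsch_X_of_ne ψ hi)
        (fun a ha => ⟨(hψs a ha).1, (hψs a ha).2.2⟩) S 3, hSf, if_pos huf3]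
  · -- (iii) the read-off is kept
    rw [hread n hnf hnM, if_neg]
    rw [pair_le_iff hlm]
    omega

end ResCone

end Summit.ResolutionOfSingularities.ResolutionOfSingularities.Theorems.PIDim4

end
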